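import Summits.ResolutionOfSingularities.ResolutionOfSingularities.Theorems.WeightedInvariantIota3LemmaCFunctional
import HarnessLib

/-!
# TRANSLATION INVARIANCE FORCES CONSTANCY: a polynomial in `X₁` alone fixed by `X₁ ↦ X₁ + εX₀^j` (`ε ≠ 0`, `j ≥ 1`) is constant
# (door `HypersurfaceCentreConstruction`, stmt-ResolutionOfSingularities-19897; engine of steps (3)/(6) of LEMMA C′, memo RESIDUE-PLAN.md §3b)

Helper for `stub_keyRungGrHomLE_three` (def-free, `--supports 19897`).  Pure algebra in `κ[X₀, X₁, X₂]`:
`LemmaC.aeval_killX₁_of_X₁_only` (killing `X₁` in a polynomial in `X₁` alone leaves its constant term),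
`LemmaC.coeff_aeval_shift_of_X₁_only` (the `X₀^{jd}` coefficient of `ψ(εX₀^j)` is `ψ_d ε^d`), and
**`LemmaC.eq_C_of_translation_invariant`**: `ψ ∈ κ[X₁]`, `ψ(X₁ + εX₀^j) = ψ` ⇒ `ψ = C ψ₀`.  In the root-curve proof of LEMMA C′ this is applied to
the `Y`-coefficients of `Ψ₂` when `τ' = 0` (forcing `Ψ₂ ∈ κ[Y]`).
[OURS · L1 W4.3 · (o70-b)/(Δ12); AI work, weaker than expert review; nothing here is a statement of the manuscript under review.]
-/

noncomputable section

open MvPolynomial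

set_option linter.dupNamespace false -- mandated namespace of this single-conjunct summit

namespace Summit.ResolutionOfSingularities.ResolutionOfSingularities.Cruxes.HypersurfaceCentreConstruction.LocalEngine

namespace Iota3

namespace LemmaC

variable {κ : Type} [Field κ]

/-- An exponent with `e₀ = e₂ = 0` is `single 1 (e 1)`. [folklore] -/
theorem eq_single_one_of_X₁_only {e : Fin 3 →₀ ℕ} (h0 : e 0 = 0) (h2 : e 2 = 0) : e = Finsupp.single 1 (e 1) := by
  ext i; fin_cases i <;> simp [h0, h2]

/-- Substituting into a polynomial in `X₁` alone: `aeval g ψ = Σ_e C(ψ_e) · (g 1)^{e₁}`. [folklore] -/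
theorem aeval_of_X₁_only {ψ : MvPolynomial (Fin 3) κ} (hψ : ∀ e ∈ ψ.support, e 0 = 0 ∧ e 2 = 0)
    (g : Fin 3 → MvPolynomial (Fin 3) κ) :
    aeval g ψ = ∑ e ∈ ψ.support, C (ψ.coeff e) * g 1 ^ (e 1) := by
  classical
  calc aeval g ψ = aeval g (∑ e ∈ ψ.support, monomial e (ψ.coeff e)) := by rw [← ψ.as_sum]
    _ = ∑ e ∈ ψ.support, aeval g (monomial e (ψ.coeff e)) := map_sum _ _ _
    _ = ∑ e ∈ ψ.support, C (ψ.coeff e) * g 1 ^ (e 1) := by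
        refine Finset.sum_congr rfl fun e he => ?_
        rw [aeval_monomial, Finsupp.prod_fintype _ _ (by simp), Fin.prod_univ_three, algebraMap_eq, (hψ e he).1,
          (hψ e he).2, pow_zero, pow_zero, one_mul, mul_one]

/-- **A polynomial in `X₁` alone fixed by `X₁ ↦ X₁ + εX₀^j` (`ε ≠ 0`, `1 ≤ j`) is constant.** [folklore] -/
theorem eq_C_of_translation_invariant {ψ : MvPolynomial (Fin 3) κ} (hψ : ∀ e ∈ ψ.support, e 0 = 0 ∧ e 2 = 0)
    {ε : κ} (hε : ε ≠ 0) {j : ℕ} (hj : 1 ≤ j) (h : aeval ![X 0, X 1 + C ε * X 0 ^ j, X 2] ψ = ψ) :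
    ψ = C (ψ.coeff 0) := by
  classical
  -- kill `X₁` on both sides of `h`
  set κ₁ : MvPolynomial (Fin 3) κ →ₐ[κ] MvPolynomial (Fin 3) κ := aeval ![X 0, (0 : MvPolynomial (Fin 3) κ), X 2] with hκ₁
  have hR : κ₁ ψ = C (ψ.coeff 0) := by
    rw [hκ₁, aeval_of_X₁_only hψ]
    simp only [Matrix.cons_val_one, Matrix.cons_val_zero]
    rw [Finset.sum_eq_single (0 : Fin 3 →₀ ℕ)]
    · rw [Finsupp.coe_zero, Pi.zero_apply, pow_zero, mul_one]
    · intro e he hne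
      have h1 : e 1 ≠ 0 := by
        intro h10
        apply hne
        rw [eq_single_one_of_X₁_only (hψ e he).1 (hψ e he).2, h10, Finsupp.single_zero]
      rw [zero_pow h1, mul_zero]
    · intro hn
      rw [notMem_support_iff.mp hn, map_zero, zero_mul]
  have hL : κ₁ (aeval ![X 0, X 1 + C ε * X 0 ^ j, X 2] ψ) = ∑ e ∈ ψ.support, C (ψ.coeff e * ε ^ (e 1)) * X 0 ^ (j * e 1) := by
    rw [← AlgHom.comp_apply, comp_aeval, aeval_of_X₁_only hψ]
    refine Finset.sum_congr rfl fun e _ => ?_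
    simp only [Matrix.cons_val_one, Matrix.cons_val_zero, map_add, map_mul, map_pow, hκ₁, aeval_X,
      aeval_C, algebraMap_eq, zero_add]
    rw [mul_pow, ← map_pow, ← pow_mul, ← mul_assoc, ← map_mul]
  have key : ∑ e ∈ ψ.support, C (ψ.coeff e * ε ^ (e 1)) * (X 0 : MvPolynomial (Fin 3) κ) ^ (j * e 1) = C (ψ.coeff 0) := by
    rw [← hL, h, hR]
  -- compare the `X₀^{jd}` coefficients: `ψ_d ε^d = 0` for `d ≥ 1`
  have hcoef : ∀ e ∈ ψ.support, e ≠ 0 → ψ.coeff e = 0 := by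
    intro e he hne
    have h1 : 1 ≤ e 1 := by
      by_contra h10
      apply hne
      rw [eq_single_one_of_X₁_only (hψ e he).1 (hψ e he).2, show e 1 = 0 by omega, Finsupp.single_zero]
    have hc := congr_arg (coeff (Finsupp.single 0 (j * e 1))) key
    rw [coeff_sum, coeff_C, if_neg, Finset.sum_eq_single e] at hc
    · rw [coeff_C_mul, coeff_X_pow, if_pos rfl, mul_one] at hc
      exact (mul_eq_zero.mp hc).resolve_right (pow_ne_zero _ hε)
    · intro e' he' hne'
      rw [coeff_C_mul, coeff_X_pow, if_neg, mul_zero]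
      intro heq
      apply hne'
      have h2 := Finsupp.ext_iff.mp heq 0
      simp only [Finsupp.single_eq_same] at h2
      have h3 : e' 1 = e 1 := Nat.eq_of_mul_eq_mul_left hj h2
      rw [eq_single_one_of_X₁_only (hψ e' he').1 (hψ e' he').2, eq_single_one_of_X₁_only (hψ e he).1 (hψ e he).2, h3]
    · intro hn; exact absurd he hn
    · intro h0
      have h2 := Finsupp.ext_iff.mp h0 0
      simp only [Finsupp.single_eq_same, Finsupp.coe_zero, Pi.zero_apply] at h2
      have : j * e 1 ≠ 0 := Nat.mul_ne_zero (by omega) (by omega)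
      exact this h2.symm
  ext e
  rw [coeff_C]
  split_ifs with h0
  · rw [← h0]
  · by_cases he : e ∈ ψ.support
    · exact hcoef e he (Ne.symm h0)
    · exact notMem_support_iff.mp he

end LemmaC

end Iota3

end Summit.ResolutionOfSingularities.ResolutionOfSingularities.Cruxes.HypersurfaceCentreConstruction.LocalEngine

end
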